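import Literature.Geometry.Lorentzian.InverseMeanCurvatureFlowRegularisedLimit
import Literature.Geometry.Lorentzian.InverseMeanCurvatureFlowArzelaAscoli
import Literature.Geometry.Lorentzian.InverseMeanCurvatureFlowIVPAssembly
import HarnessLib

/-!
# Inverse mean curvature flow I — proofs: from regularised Dirichlet solutions to the exterior
# solution (assembly of the limit `ε → 0` at fixed `L` in the proof of Thm. 3.1)

Huisken–Ilmanen prove the Weak Existence Theorem 3.1 (J. Differential Geom. 59 (2001), §3) by
solving the regularised Dirichlet problems (⋆)_ε on `Ω_L = F_L ∖ Ē₀` (Lemmas 3.4–3.5), letting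
`ε → 0` (Arzelà–Ascoli, Compactness Theorem 2.1) and `L → ∞`. This file assembles the limit
`ε → 0` at fixed `L` from the analytic output of Lemmas 3.4–3.5 taken as hypotheses
(`exists_isWeakSolution_ge_of_regularised_dirichlet`): given classical solutions `w_k ∈ C²` of
(⋆)_{ε_k} on `Ω = U ∖ Ē₀`, `ε_k → 0`, with local gradient bounds on `Ω` uniform in `k`
((3.6)/(3.9)), Lipschitz bounds up to `∂E₀` and `w_k = 0` on `∂E₀` ((3.7) at the inner boundary),
`w_k ≥ −η_k → 0` and pointwise upper bounds, and the lower barrier `w_k ≥ b − δ` off a compact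
subset of `U` for every `δ > 0` ((3.7) at the outer boundary, `b = L − 2`), a subsequence converges
locally uniformly on `U ∖ E₀` to a weak solution `u` of (1.5) on `Ω` with `u ≥ 0`, `u = 0` on
`∂E₀` and — the point of step 2 of the printed proof — `u ≥ min(v, b)` on `Ω` for the given weak
subsolution `v` at infinity (normalised so that `Ē₀ ⊆ F₀ = {v < 0}`).

The lower bound is obtained *without* the conic modification of the metric of loc. cit.: by the
interior comparison principle Thm. 2.2 (i) on `U ∖ F̄₀` applied to `min(v, b) − δ`
(`IsWeakSupersolution.le_of_isWeakSubsolution_of_forall_pos`), the Dirichlet data making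
`{u < min(v, b) − δ}` compactly contained. The other ingredients: Arzelà–Ascoli
(`exists_strictMono_tendstoLocallyUniformlyOn_of_lipschitzOnWith`), gradient bounds ⟹
equi-Lipschitz (`exists_nhds_subset_forall_lipschitzOnWith_of_gradNorm_le`), and the `ε → 0`
theorem `isWeakSolution_of_regularised_limit` (calibration + approximate compactness).

Everything is proved; there are no definitions and no named facts.

## References

* G. Huisken, T. Ilmanen, *The inverse mean curvature flow and the Riemannian Penrose
  inequality*, J. Differential Geom. 59 (2001) 353–437: §3, Lemmas 3.4–3.5 and the proof of
  Thm. 3.1, steps 1–2.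
-/

noncomputable section

open Bundle Set Manifold TopologicalSpace Filter MeasureTheory Function
open scoped ContDiff Topology ENNReal NNReal Manifold Real

namespace Literature.Geometry.Lorentzian

open PseudoRiemannianMetric

variable {X : Type*} [TopologicalSpace X] [ChartedSpace E3 X] [IsManifold (𝓡 3) ∞ X]
  (h : ContMDiffRiemannianMetric (𝓡 3) ∞ E3 (TangentSpace (𝓡 3) : X → Type _))
  [T2Space X] [LocallyCompactSpace X] [MeasurableSpace X] [BorelSpace X]
  [SecondCountableTopology X]

/-! ### Locally uniform convergence up to an anchored boundary -/

omit [MeasurableSpace X] [BorelSpace X] in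
set_option backward.isDefEq.respectTransparency false in
/-- **Extending locally uniform convergence to anchored boundary points.** Let `f_k → g` locally
uniformly on the open set `Ω`, and suppose that at every point `x ∈ S ∖ Ω` all `f_k` and `g`
take the same value (`f_k x = g x`), and near `x` all `f_k` are `K`-Lipschitz on a relative
neighbourhood in `S` (Riemannian distance), on which `f_k → g` pointwise. Then `f_k → g` locally
uniformly on `S` (`|f_k y − g y| ≤ |f_k y − f_k x| + |g x − g y| ≤ 2 K d(x, y)`, the limit being
`K`-Lipschitz too). Used with `S = U ∖ E₀`, `Ω = U ∖ Ē₀` and the anchors `f_k = 0` on `∂E₀`.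
[folklore] -/
theorem tendstoLocallyUniformlyOn_of_anchored {f : ℕ → X → ℝ} {g : X → ℝ} {Ω S : Set X}
    (hΩ : IsOpen Ω) (hconv : TendstoLocallyUniformlyOn f g atTop Ω)
    (hpt : ∀ y ∈ S, Tendsto (fun k ↦ f k y) atTop (𝓝 (g y)))
    (hanch : letI : RiemannianBundle (fun x : X ↦ TangentSpace (𝓡 3) x) :=
        ⟨h.toContinuousRiemannianMetric.toRiemannianMetric⟩
      letI : PseudoEMetricSpace X := .ofRiemannianMetric (𝓡 3) X
      ∀ x ∈ S, x ∉ Ω → (∀ k, f k x = g x) ∧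
        ∃ K : ℝ≥0, ∃ V ∈ 𝓝 x, ∀ k, LipschitzOnWith K (f k) (V ∩ S)) :
    TendstoLocallyUniformlyOn f g atTop S := by
  letI : RiemannianBundle (fun x : X ↦ TangentSpace (𝓡 3) x) :=
    ⟨h.toContinuousRiemannianMetric.toRiemannianMetric⟩
  letI : PseudoEMetricSpace X := .ofRiemannianMetric (𝓡 3) X
  rw [Metric.tendstoLocallyUniformlyOn_iff] at hconv ⊢
  intro ε hε x hx
  by_cases hxΩ : x ∈ Ω
  · obtain ⟨t, ht, hev⟩ := hconv ε hε x hxΩ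
    refine ⟨t ∩ Ω, ?_, ?_⟩
    · have : t ∩ Ω ∈ 𝓝[Ω] x := inter_mem ht self_mem_nhdsWithin
      have hΩn : Ω ∈ 𝓝 x := hΩ.mem_nhds hxΩ
      rw [nhdsWithin_eq_nhds.2 hΩn] at this
      exact mem_nhdsWithin_of_mem_nhds this
    · filter_upwards [hev] with n hn y hy using hn y hy.1
  · obtain ⟨hfx, K, V, hV, hK⟩ := hanch x hx hxΩ
    have hxV : x ∈ V := mem_of_mem_nhds hV
    have hgK : LipschitzOnWith K g (V ∩ S) :=
      lipschitzOnWith_of_tendsto (Eventually.of_forall hK) fun y hy ↦ hpt y hy.2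
    set η : ℝ := ε / (4 * (K + 1)) with hη
    have hη0 : 0 < η := by positivity
    have hKη : (K : ℝ) * η ≤ ε / 4 := by
      rw [hη, mul_div_assoc', div_le_div_iff₀ (by positivity) (by positivity)]
      nlinarith [NNReal.coe_nonneg K, hε.le]
    refine ⟨V ∩ S ∩ Metric.eball x (ENNReal.ofReal η), ?_, Eventually.of_forall fun n y hy ↦ ?_⟩
    · have h1 : V ∩ Metric.eball x (ENNReal.ofReal η) ∈ 𝓝 x :=
        inter_mem hV (Metric.eball_mem_nhds x (by simpa using hη0))
      have h2 : V ∩ S ∩ Metric.eball x (ENNReal.ofReal η) = S ∩ (V ∩ Metric.eball x (ENNReal.ofReal η)) := by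
        ext y; simp only [mem_inter_iff]; tauto
      rw [h2]
      exact inter_mem_nhdsWithin S h1
    · obtain ⟨⟨hyV, hyS⟩, hyball⟩ := hy
      have hxy : edist x y ≤ ENNReal.ofReal η := by
        rw [edist_comm]; exact (Metric.mem_eball.1 hyball).le
      have h1 : |g x - g y| ≤ K * η :=
        abs_sub_le_of_lipschitzOnWith hgK ⟨hxV, hx⟩ ⟨hyV, hyS⟩ hη0.le hxy
      have h2 : |f n x - f n y| ≤ K * η :=
        abs_sub_le_of_lipschitzOnWith (hK n) ⟨hxV, hx⟩ ⟨hyV, hyS⟩ hη0.le hxy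
      rw [Real.dist_eq]
      have h3 : f n x = g x := hfx n
      calc |g y - f n y| = |(g y - g x) + (f n x - f n y)| := by rw [h3]; ring_nf
        _ ≤ |g y - g x| + |f n x - f n y| := abs_add_le _ _
        _ < ε := by rw [abs_sub_comm (g y) (g x)]; linarith

/-! ### The limit `ε → 0` at fixed `L` -/

variable [ConnectedSpace X] [NoncompactSpace X] [(ofRiemannian h).HasLeviCivita]

set_option backward.isDefEq.respectTransparency false in
/-- **From regularised Dirichlet solutions to a weak solution above the subsolution** (the limit
`ε → 0` at fixed `L` in Huisken–Ilmanen's proof of Thm. 3.1, with the lower bound of step 2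
obtained by interior comparison). Data: `E₀` open with `Ē₀ ⊆ U`, `U` open, `Ω = U ∖ Ē₀`; a weak
subsolution `v` of (††) with initial condition `F₀ ⊇ Ē₀`; classical solutions `w_k ∈ C²(X)` of
(⋆)_{ε_k} on `Ω` (`ψ_k Δw_k − h⁻¹(dψ_k, dw_k) = ψ_k³`, `ψ_k = √(|∇w_k|² + ε_k²) ∈ C¹(Ω)`),
`ε_k > 0`, `ε_k → 0`, with: local gradient bounds on `Ω` uniform in `k`; uniform Lipschitz bounds
near the points of `∂E₀` on relative neighbourhoods in `X ∖ E₀`; `w_k = 0` on `∂E₀`;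
`w_k ≥ −η_k` on `U ∖ E₀` with `η_k → 0`; pointwise upper bounds on `U ∖ E₀`; and for every `δ > 0`
a compact `C ⊆ U` off which `w_k ≥ b − δ` on `U` (all `k`). Conclusion: a subsequence converges
locally uniformly on `U ∖ E₀` to a function `u` which is a weak solution of (1.5) on `Ω`, vanishes
on `∂E₀`, is `≥ 0` on `U ∖ E₀`, and satisfies `u ≥ min(v, b)` on `Ω`.
[cite: HuiskenIlmanenIMCF2001, §3 proof of Thm. 3.1 (steps 1–2) with Lemmas 3.4–3.5 as input] -/
theorem exists_isWeakSolution_ge_of_regularised_dirichlet {E₀ U F₀ : Set X} (hE₀ : IsOpen E₀)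
    (hU : IsOpen U) (hE₀U : closure E₀ ⊆ U) {v : X → ℝ} (hv : IsWeakSubsolutionIVP h v F₀)
    (hE₀F₀ : closure E₀ ⊆ F₀) {w : ℕ → X → ℝ} {ε : ℕ → ℝ} {ψ : ℕ → X → ℝ} {η : ℕ → ℝ} {b : ℝ}
    (hw : ∀ k, ContMDiff (𝓡 3) 𝓘(ℝ, ℝ) 2 (w k)) (hε : ∀ k, 0 < ε k)
    (hε0 : Tendsto ε atTop (𝓝 0))
    (hψ : ∀ k x, ψ k x = Real.sqrt (gradNorm h (w k) x ^ 2 + ε k ^ 2))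
    (hψ1 : ∀ k, ContMDiffOn (𝓡 3) 𝓘(ℝ, ℝ) 1 (ψ k) (U \ closure E₀))
    (hpde : ∀ k, ∀ x ∈ U \ closure E₀, ψ k x * (ofRiemannian h).dalembertian (w k) x -
      (ofRiemannian h).innerDual x (mvfderiv (𝓡 3) (ψ k) x).toLinearMap
        (mvfderiv (𝓡 3) (w k) x).toLinearMap = ψ k x ^ 3)
    (hgrad : ∀ x ∈ U \ closure E₀, ∃ C : ℝ≥0, ∃ V ∈ 𝓝 x, ∀ k, ∀ q ∈ V, gradNorm h (w k) q ≤ C)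
    (hblip : letI : RiemannianBundle (fun x : X ↦ TangentSpace (𝓡 3) x) :=
        ⟨h.toContinuousRiemannianMetric.toRiemannianMetric⟩
      letI : PseudoEMetricSpace X := .ofRiemannianMetric (𝓡 3) X
      ∀ x ∈ frontier E₀, ∃ K : ℝ≥0, ∃ V ∈ 𝓝 x, ∀ k, LipschitzOnWith K (w k) (V ∩ E₀ᶜ))
    (hzero : ∀ k, ∀ x ∈ frontier E₀, w k x = 0)
    (hη : Tendsto η atTop (𝓝 0)) (hlow : ∀ k, ∀ x ∈ U, x ∉ E₀ → -η k ≤ w k x)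
    (hup : ∀ x ∈ U, x ∉ E₀ → ∃ B : ℝ, ∀ k, w k x ≤ B)
    (hbar : ∀ δ : ℝ, 0 < δ → ∃ C : Set X, IsCompact C ∧ C ⊆ U ∧
      ∀ k, ∀ x ∈ U, x ∉ C → b - δ ≤ w k x) :
    ∃ (u : X → ℝ) (φ : ℕ → ℕ), StrictMono φ ∧
      TendstoLocallyUniformlyOn (fun n ↦ w (φ n)) u atTop (U ∩ E₀ᶜ) ∧
      IsWeakSolution h u (U \ closure E₀) ∧ (∀ x ∈ frontier E₀, u x = 0) ∧
      (∀ x ∈ U, x ∉ E₀ → 0 ≤ u x) ∧ ∀ x ∈ U \ closure E₀, min (v x) b ≤ u x := by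
  classical
  letI : RiemannianBundle (fun x : X ↦ TangentSpace (𝓡 3) x) :=
    ⟨h.toContinuousRiemannianMetric.toRiemannianMetric⟩
  letI : PseudoEMetricSpace X := .ofRiemannianMetric (𝓡 3) X
  set Ω : Set X := U \ closure E₀ with hΩdef
  have hΩo : IsOpen Ω := hU.sdiff isClosed_closure
  have hfront : frontier E₀ = closure E₀ \ E₀ := by
    rw [frontier, hE₀.interior_eq]
  -- `U ∩ E₀ᶜ = Ω ∪ ∂E₀`
  have hdecomp : ∀ x ∈ U, x ∉ E₀ → x ∈ Ω ∨ x ∈ frontier E₀ := fun x hxU hxE ↦ by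
    by_cases hxc : x ∈ closure E₀
    · exact Or.inr (hfront ▸ ⟨hxc, hxE⟩)
    · exact Or.inl ⟨hxU, hxc⟩
  have hfrontU : frontier E₀ ⊆ U := fun x hx ↦ hE₀U (frontier_subset_closure hx)
  have hfrontE : ∀ x ∈ frontier E₀, x ∉ E₀ := fun x hx ↦ (hfront ▸ hx).2
  -- (1) equi-Lipschitz in `k` near every point of `Ω` (gradient bounds)
  have hlipΩ : ∀ x ∈ Ω, ∃ K : ℝ≥0, ∃ V ∈ 𝓝 x, ∀ k, LipschitzOnWith K (w k) V := by
    intro x hx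
    obtain ⟨C, V, hV, hC⟩ := hgrad x hx
    obtain ⟨W, hW, hWV, c, hc⟩ := exists_nhds_subset_forall_lipschitzOnWith_of_gradNorm_le h x hV
    exact ⟨C * c, W, hW, fun k ↦ hc (w k) C
      (fun q _ ↦ ((hw k).of_le (by norm_num)).mdifferentiableAt one_ne_zero)
      fun q hq ↦ hC k q (hWV hq)⟩
  -- (2) Arzelà–Ascoli on `Ω`
  have hbddΩ : ∀ x ∈ Ω, ∃ B : ℝ, ∀ k, |w k x| ≤ B := by
    intro x hx
    have hxE : x ∉ E₀ := fun h' ↦ hx.2 (subset_closure h')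
    obtain ⟨B, hB⟩ := hup x hx.1 hxE
    obtain ⟨B', hB'⟩ : ∃ B', ∀ k, -B' ≤ w k x := by
      obtain ⟨M, hM⟩ := hη.bddAbove_range
      refine ⟨max M 0, fun k ↦ ?_⟩
      have h1 := hlow k x hx.1 hxE
      have h2 : η k ≤ M := hM ⟨k, rfl⟩
      linarith [le_max_left M 0]
    exact ⟨max B B', fun k ↦ abs_le.2 ⟨by linarith [hB' k, le_max_right B B'],
      (hB k).trans (le_max_left _ _)⟩⟩
  obtain ⟨φ, u₀, hφ, hconvΩ⟩ :=
    exists_strictMono_tendstoLocallyUniformlyOn_of_lipschitzOnWith h hΩo hlipΩ hbddΩ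
  -- the limit function: `u₀` on `Ω`, `0` elsewhere
  set u : X → ℝ := fun x ↦ if x ∈ Ω then u₀ x else 0 with hudef
  have huΩ : ∀ x ∈ Ω, u x = u₀ x := fun x hx ↦ by simp only [hudef, if_pos hx]
  have hu0 : ∀ x ∈ frontier E₀, u x = 0 := fun x hx ↦ by
    have : x ∉ Ω := fun h' ↦ h'.2 (frontier_subset_closure hx)
    simp only [hudef, if_neg this]
  have hconvΩ' : TendstoLocallyUniformlyOn (fun n ↦ w (φ n)) u atTop Ω := by
    refine hconvΩ.congr_right fun x hx ↦ (huΩ x hx).symm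
  have hptΩ : ∀ x ∈ Ω, Tendsto (fun n ↦ w (φ n) x) atTop (𝓝 (u x)) := fun x hx ↦
    hconvΩ'.tendsto_at hx
  -- (3) convergence on `U ∩ E₀ᶜ` (anchored at `∂E₀`)
  have hpt : ∀ y ∈ U ∩ E₀ᶜ, Tendsto (fun n ↦ w (φ n) y) atTop (𝓝 (u y)) := by
    intro y hy
    rcases hdecomp y hy.1 hy.2 with hyΩ | hyf
    · exact hptΩ y hyΩ
    · rw [hu0 y hyf]
      exact tendsto_const_nhds.congr fun n ↦ (hzero (φ n) y hyf).symm
  have hconv : TendstoLocallyUniformlyOn (fun n ↦ w (φ n)) u atTop (U ∩ E₀ᶜ) := by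
    refine tendstoLocallyUniformlyOn_of_anchored h hΩo hconvΩ' hpt fun x hx hxΩ ↦ ?_
    have hxf : x ∈ frontier E₀ := (hdecomp x hx.1 hx.2).resolve_left hxΩ
    refine ⟨fun k ↦ by rw [hzero (φ k) x hxf, hu0 x hxf], ?_⟩
    obtain ⟨K, V, hV, hK⟩ := hblip x hxf
    exact ⟨K, V, hV, fun k ↦ (hK (φ k)).mono fun y hy ↦ ⟨hy.1, hy.2.2⟩⟩
  -- (4) `u` is a weak solution on `Ω`
  have hsol : IsWeakSolution h u Ω := by
    refine isWeakSolution_of_regularised_limit h hΩo (fun _ ↦ hΩo) (fun n ↦ hw (φ n))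
      (fun n ↦ hε (φ n)) (hε0.comp hφ.tendsto_atTop) (fun n x ↦ hψ (φ n) x)
      (fun n ↦ hψ1 (φ n)) (fun n ↦ hpde (φ n)) (fun K _ hKΩ ↦ Eventually.of_forall fun _ ↦ hKΩ)
      hconvΩ' fun x hx ↦ ?_
    obtain ⟨C, V, hV, hC⟩ := hgrad x hx
    exact ⟨C, V, hV, Eventually.of_forall fun n q hq ↦ hC (φ n) q hq⟩
  -- (5) sign and lower barrier in the limit
  have hnonneg : ∀ x ∈ U, x ∉ E₀ → 0 ≤ u x := by
    intro x hxU hxE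
    have hlim := hpt x ⟨hxU, hxE⟩
    have hηφ : Tendsto (fun n ↦ -η (φ n)) atTop (𝓝 0) := by
      simpa using (hη.comp hφ.tendsto_atTop).neg
    exact le_of_tendsto_of_tendsto' hηφ hlim fun n ↦ hlow (φ n) x hxU hxE
  have hbar' : ∀ δ : ℝ, 0 < δ → ∃ C : Set X, IsCompact C ∧ C ⊆ U ∧
      ∀ x ∈ U, x ∉ E₀ → x ∉ C → b - δ ≤ u x := by
    intro δ hδ
    obtain ⟨C, hC, hCU, hCb⟩ := hbar δ hδ
    refine ⟨C, hC, hCU, fun x hxU hxE hxC ↦ ?_⟩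
    exact ge_of_tendsto (hpt x ⟨hxU, hxE⟩) (Eventually.of_forall fun n ↦ hCb (φ n) x hxU hxC)
  -- (6) the lower bound `u ≥ min(v, b)` by interior comparison on `U ∖ F̄₀`
  have hvc : Continuous v := hv.continuous h
  have hF₀eq : F₀ = {x | v x < 0} := hv.2.1
  have hvF : ∀ x ∈ closure F₀, v x ≤ 0 := by
    rw [hF₀eq]
    exact fun x hx ↦ closure_lt_subset_le hvc continuous_const hx
  set Ω' : Set X := U \ closure F₀ with hΩ'def
  have hΩ'o : IsOpen Ω' := hU.sdiff isClosed_closure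
  have hΩ'Ω : Ω' ⊆ Ω := fun x hx ↦ ⟨hx.1, fun h' ↦ hx.2 (closure_mono hE₀F₀ (by
    rwa [closure_closure]))⟩
  have hsub : IsWeakSubsolution h (fun x ↦ min (v x) b) Ω' :=
    (hv.inf_const h b).mono h hΩ'o fun x hx ↦ hx.2
  have hsup : IsWeakSupersolution h u Ω' :=
    ((isWeakSolution_iff_sub_and_super h hΩ'o).1 (hsol.mono h hΩ'o hΩ'Ω)).2
  have hcomp : ∀ x ∈ Ω', min (v x) b ≤ u x := by
    refine hsup.le_of_isWeakSubsolution_of_forall_pos h hsub hΩ'o fun δ hδ ↦ ?_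
    obtain ⟨C, hC, hCU, hCb⟩ := hbar' δ hδ
    refine ⟨C ∩ {x | δ ≤ v x}, hC.inter_right (isClosed_le continuous_const hvc), ?_, ?_⟩
    · rintro x ⟨hxC, hxv⟩
      refine ⟨hCU hxC, fun hxF ↦ ?_⟩
      have := hvF x hxF
      simp only [mem_setOf_eq] at hxv
      linarith
    · rintro x ⟨hxΩ', hlt⟩
      have hxU : x ∈ U := hxΩ'.1
      have hxE : x ∉ E₀ := fun h' ↦ (hΩ'Ω hxΩ').2 (subset_closure h')
      have hux : 0 ≤ u x := hnonneg x hxU hxE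
      refine ⟨by_contra fun hxC ↦ ?_, ?_⟩
      · have := hCb x hxU hxE hxC
        have : min (v x) b ≤ b := min_le_right _ _
        linarith
      · simp only [mem_setOf_eq]
        have : min (v x) b ≤ v x := min_le_left _ _
        linarith
  have hge : ∀ x ∈ Ω, min (v x) b ≤ u x := by
    intro x hx
    by_cases hxF : x ∈ closure F₀
    · have hxE : x ∉ E₀ := fun h' ↦ hx.2 (subset_closure h')
      exact (min_le_left _ _).trans ((hvF x hxF).trans (hnonneg x hx.1 hxE))
    · exact hcomp x ⟨hx.1, hxF⟩
  exact ⟨u, φ, hφ, hconv, hsol, hu0, hnonneg, hge⟩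

end Literature.Geometry.Lorentzian

end
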